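import Literature.NumberTheory.Automorphic.GL2CasimirParameter
import Literature.NumberTheory.Automorphic.GL2CentralCharacter
import Literature.NumberTheory.Automorphic.GL2AdelicWeightVectors
import Literature.NumberTheory.Automorphic.GL2ZFiniteOfEigenfunction
import Literature.NumberTheory.Automorphic.AutomorphicRepLieActionGL
import HarnessLib

/-!
# An automorphic representation of `GL₂(𝔸_ℚ)` on which `C` and `Z` act by scalars has the
# corresponding archimedean parameter (converse of the Casimir bridge)

Topic `NumberTheory/Automorphic`; theorems only (no definition, no named fact; D-0026). Brick of the
dictionary `f ↦ π_f` toward the archimedean half of `IsRegularAlgebraic`: for an automorphic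
representation `π = W / W'` of `GL₂(𝔸_ℚ)` (Borel–Jacquet datum) such that, along
`ι_𝔸 : GL₂(ℝ) → GL₂(𝔸_ℚ)`, the Casimir element `C = ∑_{a,b} E_{ab}E_{ba}` acts on `W` modulo `W'`
by the scalar `s₁² + s₂² - ½` and the centre `Z = 1` by `s₁ + s₂`, the archimedean parameter of
`π` is `{s₁, s₂}` (`AutomorphicRepData.HasArchParameter`):

* `AutomorphicRepData.hasArchParameter_of_casimir_of_zed`.

Proof: on `W / W'` the Lie algebra action `ρ𝔤 = π.lieRep` (`hasLieAction_lieRep`) restricted to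
`𝔤𝔩₂(ℝ) = 𝔤𝔩₂(ℚ_∞)` (`Rat.topEquiv_symm_realPlaceLie`) satisfies `ρ(1) = s₁ + s₂` and
`∑ ρ(E_{ab})ρ(E_{ba}) = s₁² + s₂² - ½` identically; `Z(U(𝔤𝔩₂)) = ℂ[Z, C]` then acts by the
character `θ = ev_{(s₁,s₂)} ∘ γ_{HC}` (`GL2Casimir.lift_center_apply_eq_smul_of_casimir_of_zed`,
`exists_character_lift_center_apply_eq_smul`), and `GL2Casimir.hasHCParameter_of_sum_rho_single_of_rho_one`
gives the Harish-Chandra parameter `{s₁, s₂}` at the (unique, real) place of `ℚ`. This is the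
converse of `AutomorphicRepData.sum_lieDeriv_single_sub_smul_mem` /
`lieDeriv_one_sub_smul_mem` (`GL2AdelicWeightVectors`). Knapp 2002, Thm. 5.44; Bump 1997, §2.2,
Thm. 2.2.1 ff.; Borel–Jacquet 1979, 4.6.

## References

* A. W. Knapp, *Lie Groups Beyond an Introduction* (2002), Thm. 5.44. [Knapp2002]
* D. Bump, *Automorphic Forms and Representations* (1997), §2.2. [Bump1997]
* A. Borel, H. Jacquet, Corvallis 1979, 4.6. [BorelJacquet1979]
-/

noncomputable section

open scoped MatrixGroups Matrix Classical
open NumberField NumberField.mixedEmbedding NumberField.InfinitePlace UniversalEnvelopingAlgebra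

namespace Literature.NumberTheory.Automorphic

-- Mathlib idiom (Mathlib/Algebra/Lie/OfAssociative.lean), as in `GL2WeightVectors`: Lie subalgebras of matrix algebras.
attribute [local instance 100] LieRing.ofAssociativeRing

open GL2Real GLnCasimir GL2Casimir

/-! ### Representation theory: a `𝔤𝔩₂(ℝ)`-module on which `C` and `Z` are scalars -/

section Module

variable {V : Type*} [AddCommGroup V] [Module ℂ V] (ρ : Matrix (Fin 2) (Fin 2) ℝ →ₗ⁅ℝ⁆ Module.End ℂ V)

/-- **If `C = ∑ E_{ab}E_{ba}` and `Z = 1` act on the whole `𝔤𝔩₂(ℝ)`-module `V ≠ 0` by the scalars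
`s₁² + s₂² - ½` and `s₁ + s₂`, then `V` has Harish-Chandra parameter `{s₁, s₂}`**: the centre
`Z(U(𝔤𝔩₂)) = ℂ[Z, C]` acts by the character `ev_{(s₁,s₂)} ∘ γ` on every vector
(`lift_center_apply_eq_smul_of_casimir_of_zed`), which is `HasCentralCharacter`, and
`hasHCParameter_of_sum_rho_single_of_rho_one` applies at any non-zero vector.
[cite: Knapp2002, Thm. 5.44] [cite: Bump1997, §2.2] -/
theorem GL2Casimir.hasHCParameter_of_forall_sum_rho_single_of_forall_rho_one {s₁ s₂ : ℂ}
    (hV : ∃ v : V, v ≠ 0)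
    (hC : ∀ v : V, (∑ a : Fin 2, ∑ b : Fin 2,
        ρ (Matrix.single a b (1 : ℝ)) (ρ (Matrix.single b a (1 : ℝ)) v)) = (s₁ ^ 2 + s₂ ^ 2 - 1 / 2) • v)
    (hZ : ∀ v : V, ρ (1 : Matrix (Fin 2) (Fin 2) ℝ) v = (s₁ + s₂) • v) :
    HasHCParameter ρ fun _ => ({s₁, s₂} : Multiset ℂ) := by
  obtain ⟨v₀, hv₀⟩ := hV
  -- the hypotheses at the level of `U(𝔤)`
  have hCl : ∀ v : V, lift ℝ ρ (casimir 2) v = (s₁ ^ 2 + s₂ ^ 2 - 1 / 2) • v := fun v => by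
    rw [casimir_eq_sum]
    simpa only [map_sum, LinearMap.sum_apply, lift_ιU_mul_ιU_apply] using hC v
  have hZl : ∀ v : V, lift ℝ ρ (zed 2) v = (s₁ + s₂) • v := fun v => by
    change lift ℝ ρ (ι ℝ (1 : Matrix (Fin 2) (Fin 2) ℝ)) v = _
    rw [lift_ι_apply]
    exact hZ v
  obtain ⟨θ, -, -, hθ₀⟩ := exists_character_lift_center_apply_eq_smul ρ (hCl v₀) (hZl v₀)
  have hθ : HasCentralCharacter ρ θ := by
    intro u
    refine LinearMap.ext fun v => ?_
    rw [Module.algebraMap_end_apply]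
    have h1 := lift_center_apply_eq_smul_of_casimir_of_zed ρ (hCl v) (hZl v) u
    have h2 := lift_center_apply_eq_smul_of_casimir_of_zed ρ (hCl v₀) (hZl v₀) u
    rw [hθ₀ u] at h2
    have h3 := smul_left_injective ℂ hv₀ h2
    rw [h1, ← h3]
  exact hasHCParameter_of_sum_rho_single_of_rho_one hθ hv₀ (hC v₀) (hZ v₀)

end Module

/-! ### Automorphic representations of `GL₂(𝔸_ℚ)` -/

namespace AutomorphicRepData

variable {hcpt : isCompact_glFiniteIntegralLevel 2 ℚ} (π : AutomorphicRepData (AutomorphyDatum.gl 2 ℚ hcpt))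

/-- **Casimir and centre scalars on `W / W'` give the archimedean parameter.** Let `π = W / W'` be an
automorphic representation of `GL₂(𝔸_ℚ)`. If for every `ψ ∈ W`,
`∑_{a,b} E_{ab}(E_{ba} ψ) - (s₁² + s₂² - ½) ψ ∈ W'` and `Z ψ - (s₁ + s₂) ψ ∈ W'` (Lie derivatives along
`ι_𝔸`), then `π` has archimedean parameter `{s₁, s₂}`: with `ρ𝔤 = π.lieRep`
(`hasLieAction_lieRep`) and `𝔤𝔩₂(ℚ_∞) = 𝔤𝔩₂(ℝ)` (`Rat.topEquiv_symm_realPlaceLie`,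
`Rat.lieDeriv_ofArch_lieOfReal_eq`), `C` and `Z` are scalars on `W / W'` and
`GL2Casimir.hasHCParameter_of_forall_sum_rho_single_of_forall_rho_one` applies; `ℚ` has no complex
place. Converse of `sum_lieDeriv_single_sub_smul_mem`, `lieDeriv_one_sub_smul_mem`.
[cite: Knapp2002, Thm. 5.44] [cite: BorelJacquet1979, 4.6] [cite: Bump1997, §2.2] -/
theorem hasArchParameter_of_casimir_of_zed {s₁ s₂ : ℂ}
    (hC : ∀ ψ ∈ π.W, (∑ a : Fin 2, ∑ b : Fin 2, lieDeriv Rat.iotaA (toLie (Matrix.single a b (1 : ℝ)))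
        (lieDeriv Rat.iotaA (toLie (Matrix.single b a (1 : ℝ))) ψ)) - (s₁ ^ 2 + s₂ ^ 2 - 1 / 2) • ψ ∈ π.W')
    (hZ : ∀ ψ ∈ π.W, lieDeriv Rat.iotaA (toLie 1) ψ - (s₁ + s₂) • ψ ∈ π.W') :
    π.HasArchParameter fun _ => ({s₁, s₂} : Multiset ℂ) := by
  haveI := Rat.isEmpty_isComplex_infinitePlace
  refine ⟨π.lieRep, π.hasLieAction_lieRep, fun w => ?_, fun w => isEmptyElim w⟩
  set ρ' := (π.lieRep.comp (LieSubalgebra.topEquiv :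
      (⊤ : LieSubalgebra ℝ (Matrix (Fin 2) (Fin 2) (mixedSpace ℚ))) ≃ₗ⁅ℝ⁆
        Matrix (Fin 2) (Fin 2) (mixedSpace ℚ)).symm.toLieHom).comp (realPlaceLie 2 w) with hρ'
  have hact : ∀ (X : Matrix (Fin 2) (Fin 2) ℝ) (ψ : π.W),
      ρ' X (π.mkQ ψ) = π.mkQ (π.lieDerivW (Rat.lieOfReal hcpt X) ψ) := by
    intro X ψ
    change π.lieRep ((LieSubalgebra.topEquiv : (⊤ : LieSubalgebra ℝ (Matrix (Fin 2) (Fin 2) (mixedSpace ℚ))) ≃ₗ⁅ℝ⁆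
        Matrix (Fin 2) (Fin 2) (mixedSpace ℚ)).symm (realPlaceLie 2 w X)) (π.mkQ ψ) = _
    rw [Rat.topEquiv_symm_realPlaceLie]
    exact π.hasLieAction_lieRep _ _
  have hcoe1 : ∀ (X : Matrix (Fin 2) (Fin 2) ℝ) (ψ : π.W),
      ((π.lieDerivW (Rat.lieOfReal hcpt X) ψ : π.W) : (AdelicGroupData.gl 2 ℚ).Adelic → ℂ) =
        lieDeriv Rat.iotaA (toLie X) ψ := fun X ψ => by
    change lieDeriv (AutomorphyDatum.gl 2 ℚ hcpt).ofArch (Rat.lieOfReal hcpt X) ψ = _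
    rw [Rat.lieDeriv_ofArch_lieOfReal_eq]
  -- `Z = s₁ + s₂` on `W / W'`
  have hZ' : ∀ v : π.Quot, ρ' (1 : Matrix (Fin 2) (Fin 2) ℝ) v = (s₁ + s₂) • v := by
    intro v
    obtain ⟨ψ, rfl⟩ := Submodule.mkQ_surjective π.kerQuot v
    rw [hact, ← map_smul, ← sub_eq_zero, ← map_sub, Submodule.mkQ_apply, Submodule.Quotient.mk_eq_zero]
    change (((π.lieDerivW (Rat.lieOfReal hcpt 1) ψ - (s₁ + s₂) • ψ : π.W)) : (AdelicGroupData.gl 2 ℚ).Adelic → ℂ) ∈ π.W'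
    rw [Submodule.coe_sub, Submodule.coe_smul, hcoe1]
    exact hZ ψ ψ.2
  -- `C = s₁² + s₂² - ½` on `W / W'`
  have hC' : ∀ v : π.Quot, (∑ a : Fin 2, ∑ b : Fin 2,
      ρ' (Matrix.single a b (1 : ℝ)) (ρ' (Matrix.single b a (1 : ℝ)) v)) = (s₁ ^ 2 + s₂ ^ 2 - 1 / 2) • v := by
    intro v
    obtain ⟨ψ, rfl⟩ := Submodule.mkQ_surjective π.kerQuot v
    simp only [hact]
    rw [← map_smul]
    simp only [← map_sum]
    rw [← sub_eq_zero, ← map_sub, Submodule.mkQ_apply, Submodule.Quotient.mk_eq_zero]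
    change (((∑ a : Fin 2, ∑ b : Fin 2, π.lieDerivW (Rat.lieOfReal hcpt (Matrix.single a b (1 : ℝ)))
      (π.lieDerivW (Rat.lieOfReal hcpt (Matrix.single b a (1 : ℝ))) ψ) -
        (s₁ ^ 2 + s₂ ^ 2 - 1 / 2) • ψ : π.W)) : (AdelicGroupData.gl 2 ℚ).Adelic → ℂ) ∈ π.W'
    have hcoe2 : ∀ (X Y : Matrix (Fin 2) (Fin 2) ℝ),
        ((π.lieDerivW (Rat.lieOfReal hcpt X) (π.lieDerivW (Rat.lieOfReal hcpt Y) ψ) : π.W) :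
          (AdelicGroupData.gl 2 ℚ).Adelic → ℂ) = lieDeriv Rat.iotaA (toLie X) (lieDeriv Rat.iotaA (toLie Y) ψ) := by
      intro X Y
      change lieDeriv (AutomorphyDatum.gl 2 ℚ hcpt).ofArch (Rat.lieOfReal hcpt X)
        (lieDeriv (AutomorphyDatum.gl 2 ℚ hcpt).ofArch (Rat.lieOfReal hcpt Y) ψ) = _
      rw [Rat.lieDeriv_ofArch_lieOfReal_eq, Rat.lieDeriv_ofArch_lieOfReal_eq]
    rw [Submodule.coe_sub, Submodule.coe_smul, Submodule.coe_sum]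
    simp only [Submodule.coe_sum, hcoe2]
    exact hC ψ ψ.2
  -- a non-zero vector
  have hV : ∃ v : π.Quot, v ≠ 0 := by
    obtain ⟨φ₀, hφ₀W, hφ₀W'⟩ := SetLike.exists_of_lt π.lt
    refine ⟨π.mkQ ⟨φ₀, hφ₀W⟩, fun h0 => hφ₀W' ?_⟩
    rw [Submodule.mkQ_apply, Submodule.Quotient.mk_eq_zero] at h0
    exact h0
  exact GL2Casimir.hasHCParameter_of_forall_sum_rho_single_of_forall_rho_one ρ' hV hC' hZ'

end AutomorphicRepData

end Literature.NumberTheory.Automorphic
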